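import Mathlib
import Literature.LinearAlgebra.Matrix.ZMatrixSemipositive
import Literature.LinearAlgebra.Matrix.BauerFike
import HarnessLib

/-!
# Ostrowski's theorem: `|A⁻¹| ≤ 𝓜(A)⁻¹` entrywise for an H-matrix `A`

Topic `Literature/LinearAlgebra/Matrix`; support file (one cited definition — the comparison
matrix `𝓜(A)`; everything else PROVED; no named facts). Continues
`…Matrix.ZMatrixSemipositive` (semipositive Z-matrices are monotone with `A⁻¹ ≥ 0`), which is
applied here to the comparison matrix.

For a square matrix `A` over a normed field, the comparison matrix `𝓜(A)` has entries `‖aᵢᵢ‖` on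
the diagonal and `−‖aᵢⱼ‖` off it (Berman–Plemmons (6.2.8), Axelsson Def. 6.2); `A` is an
H-matrix when `𝓜(A)` is a nonsingular M-matrix, equivalently (Axelsson Lemma 7.7, "generalized
strict diagonal dominance") when there is `u ≫ 0` with `𝓜(A) u ≫ 0`, i.e.
`‖aᵢᵢ‖ uᵢ > Σ_{j≠i} ‖aᵢⱼ‖ uⱼ` for all `i` — the hypothesis `(hu, hMu)` below.

Typed here:
* `comparisonMatrix` and its bookkeeping (`_apply_same`, `_apply_of_ne`, `isZMatrix_…`,
  `_mulVec_apply`);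
* the row inequality behind everything: `(𝓜(A) |x|)ᵢ ≤ ‖(A x)ᵢ‖`
  (`comparisonMatrix_mulVec_norm_le`);
* OSTROWSKI (1937): for an H-matrix `A`, `|x| ≤ 𝓜(A)⁻¹ |A x|` for every `x`
  (`norm_apply_le_comparisonInv_mulVec`), hence `A` is nonsingular
  (`isUnit_det_of_comparison_semipositive`), `|A⁻¹ b| ≤ 𝓜(A)⁻¹ |b|`
  (`norm_inv_mulVec_le_comparisonInv_mulVec`) and, column by column, the entrywise domination
  `‖(A⁻¹)ᵢⱼ‖ ≤ (𝓜(A)⁻¹)ᵢⱼ` (`norm_inv_apply_le_comparisonInv`, Axelsson Lemma 8.15);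
* consequences: absolute row sums and the `ℓ∞` operator norm, `‖A⁻¹‖_∞ ≤ ‖𝓜(A)⁻¹‖_∞` (the
  inequality `‖B⁻¹‖_∞ ≤ ‖𝓜(A)⁻¹‖_∞`, `B = A ∈ Ω_A`, of Varga's Thm 2 (4.7)).

Proof route (monotonicity, not the Neumann series of Axelsson's proof): `𝓜(A)` is a semipositive
Z-matrix, hence monotone (`IsZMatrix.le_of_mulVec_le`); the triangle inequality on row `i` of
`A x = b` gives `𝓜(A) |x| ≤ |b| = 𝓜(A) (𝓜(A)⁻¹ |b|)`, so `|x| ≤ 𝓜(A)⁻¹ |b|`.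

NOT TYPED here: the equality `sup_{B ∈ Ω_A} ‖B⁻¹‖_∞ = ‖𝓜(A)⁻¹‖_∞` of Varga's Thm 2, the converse
characterisations of H-matrices (Berman–Plemmons Thm. 7.5.14), block H-matrices.

References:
* A. M. Ostrowski, *Über die Determinanten mit überwiegender Hauptdiagonale*, Comment. Math.
  Helv. 10 (1937) 69–96. [Ostrowski1937]
* O. Axelsson, *Iterative Solution Methods*, Cambridge Univ. Press 1994, Def. 6.2, Lemma 7.7,
  Lemma 8.15 ("Ostrowski's theorem: let `A` be an H-matrix … then `|A⁻¹| ≤ 𝓜(A)⁻¹`"). Held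
  `book:axelssonnd-iterative-solution-methods`, PDF p. 260 (Lemma 8.15), p. 216 (Lemma 7.7).
  [Axelsson1994]
* A. Berman, R. J. Plemmons, *Nonnegative Matrices in the Mathematical Sciences*, SIAM Classics 9
  (1994), Ch. 6 (2.8) Definitions (comparison matrix, equimodular set). [BermanPlemmons1994]
* R. S. Varga, *M-matrix theory and recent results in numerical linear algebra*, in: Sparse
  Matrix Computations, Academic Press 1976, §4 Thm 2 (4.7). [Varga1976MMatrixTheory]
-/

namespace Literature.LinearAlgebra.Matrix

open scoped _root_.Matrix
open Finset _root_.Matrix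

variable {n : Type*} [Fintype n] [DecidableEq n] {K : Type*} [NormedField K]

/-! ### The comparison matrix -/

/-- The **comparison matrix** `𝓜(A)` of a square matrix `A` over a normed field: the real matrix
with `‖A i i‖` on the diagonal and `-‖A i j‖` off the diagonal.
[cite: BermanPlemmons1994, Ch. 6, (2.8) Definitions] [cite: Axelsson1994, Def. 6.2] -/
def comparisonMatrix (A : Matrix n n K) : Matrix n n ℝ :=
  Matrix.of fun i j => if i = j then ‖A i j‖ else -‖A i j‖

omit [Fintype n] in
/-- Diagonal entries of the comparison matrix. [cite: BermanPlemmons1994, Ch. 6, (2.8)] -/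
@[simp] theorem comparisonMatrix_apply_same (A : Matrix n n K) (i : n) :
    comparisonMatrix A i i = ‖A i i‖ := by
  simp [comparisonMatrix]

omit [Fintype n] in
/-- Off-diagonal entries of the comparison matrix. [cite: BermanPlemmons1994, Ch. 6, (2.8)] -/
theorem comparisonMatrix_apply_of_ne (A : Matrix n n K) {i j : n} (h : i ≠ j) :
    comparisonMatrix A i j = -‖A i j‖ := by
  simp [comparisonMatrix, h]

omit [Fintype n] in
/-- The comparison matrix is a Z-matrix. [cite: BermanPlemmons1994, Ch. 6, (2.8)] -/
theorem isZMatrix_comparisonMatrix (A : Matrix n n K) : IsZMatrix (comparisonMatrix A) :=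
  fun _ _ h => by
    rw [comparisonMatrix_apply_of_ne A h]
    exact neg_nonpos.2 (norm_nonneg _)

/-- Row `i` of `𝓜(A) u`: `‖aᵢᵢ‖ uᵢ − Σ_{j ≠ i} ‖aᵢⱼ‖ uⱼ` (so `𝓜(A) u ≫ 0` is generalized strict
diagonal dominance). [cite: Axelsson1994, Lemma 7.7] -/
theorem comparisonMatrix_mulVec_apply (A : Matrix n n K) (u : n → ℝ) (i : n) :
    (comparisonMatrix A *ᵥ u) i = ‖A i i‖ * u i - ∑ j ∈ univ.erase i, ‖A i j‖ * u j := by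
  simp only [mulVec, dotProduct]
  rw [← Finset.add_sum_erase _ _ (mem_univ i), comparisonMatrix_apply_same, sub_eq_add_neg,
    ← sum_neg_distrib]
  congr 1
  exact sum_congr rfl fun j hj => by
    rw [comparisonMatrix_apply_of_ne A (ne_of_mem_erase hj).symm, neg_mul]

/-- **The row inequality** behind Ostrowski's theorem: for every vector `x` and index `i`,
`(𝓜(A) |x|)ᵢ = ‖aᵢᵢ‖ ‖xᵢ‖ − Σ_{j≠i} ‖aᵢⱼ‖ ‖xⱼ‖ ≤ ‖(A x)ᵢ‖` (triangle inequality on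
`aᵢᵢ xᵢ = (A x)ᵢ − Σ_{j≠i} aᵢⱼ xⱼ`). [cite: Axelsson1994, Lemma 8.15] -/
theorem comparisonMatrix_mulVec_norm_le (A : Matrix n n K) (x : n → K) (i : n) :
    (comparisonMatrix A *ᵥ fun j => ‖x j‖) i ≤ ‖(A *ᵥ x) i‖ := by
  rw [comparisonMatrix_mulVec_apply, sub_le_iff_le_add]
  have hsplit : (A *ᵥ x) i = A i i * x i + ∑ j ∈ univ.erase i, A i j * x j := by
    simp only [mulVec, dotProduct]
    rw [← Finset.add_sum_erase _ _ (mem_univ i)]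
  calc ‖A i i‖ * ‖x i‖ = ‖A i i * x i‖ := (norm_mul _ _).symm
    _ = ‖(A *ᵥ x) i - ∑ j ∈ univ.erase i, A i j * x j‖ := by rw [hsplit, add_sub_cancel_right]
    _ ≤ ‖(A *ᵥ x) i‖ + ‖∑ j ∈ univ.erase i, A i j * x j‖ := norm_sub_le _ _
    _ ≤ ‖(A *ᵥ x) i‖ + ∑ j ∈ univ.erase i, ‖A i j‖ * ‖x j‖ := by
        gcongr
        exact (norm_sum_le _ _).trans (le_of_eq (sum_congr rfl fun j _ => norm_mul _ _))

/-! ### Ostrowski's theorem for H-matrices -/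

section HMatrix

variable {A : Matrix n n K} {u : n → ℝ}

/-- **Ostrowski majorisation** `|x| ≤ 𝓜(A)⁻¹ |A x|` for an H-matrix `A` (`u ≫ 0`, `𝓜(A) u ≫ 0`):
`𝓜(A)` is a semipositive Z-matrix, hence monotone, and `𝓜(A) |x| ≤ |A x| = 𝓜(A) (𝓜(A)⁻¹ |A x|)`.
[cite: Axelsson1994, Lemma 8.15] [cite: Ostrowski1937] -/
theorem norm_apply_le_comparisonInv_mulVec (hu : ∀ i, 0 < u i)
    (hMu : ∀ i, 0 < (comparisonMatrix A *ᵥ u) i) (x : n → K) (i : n) :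
    ‖x i‖ ≤ ((comparisonMatrix A)⁻¹ *ᵥ fun j => ‖(A *ᵥ x) j‖) i := by
  have hZ := isZMatrix_comparisonMatrix A
  have hU := hZ.isUnit_det_of_semipositive hu hMu
  exact hZ.le_of_mulVec_le hu hMu (v := fun j => ‖x j‖)
    (w := (comparisonMatrix A)⁻¹ *ᵥ fun j => ‖(A *ᵥ x) j‖) (fun k => by
      rw [mulVec_mulVec, mul_nonsing_inv _ hU, one_mulVec]
      exact comparisonMatrix_mulVec_norm_le A x k) i

/-- **An H-matrix is nonsingular** (`u ≫ 0`, `𝓜(A) u ≫ 0` ⇒ `det A` is a unit): by the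
majorisation, `A x = A y` forces `|x − y| ≤ 𝓜(A)⁻¹ 0 = 0`.
[cite: Axelsson1994, Lemma 7.7] [cite: Ostrowski1937] -/
theorem isUnit_det_of_comparison_semipositive (hu : ∀ i, 0 < u i)
    (hMu : ∀ i, 0 < (comparisonMatrix A *ᵥ u) i) : IsUnit A.det := by
  rw [← isUnit_iff_isUnit_det, ← mulVec_injective_iff_isUnit]
  intro x y hxy
  funext i
  have h1 := norm_apply_le_comparisonInv_mulVec hu hMu (x - y) i
  have h0 : (fun j => ‖(A *ᵥ (x - y)) j‖) = 0 := by
    funext j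
    rw [mulVec_sub, Pi.sub_apply, hxy, sub_self, norm_zero, Pi.zero_apply]
  rw [h0, mulVec_zero, Pi.zero_apply] at h1
  exact sub_eq_zero.1 (norm_le_zero_iff.1 h1)

/-- **Ostrowski majorisation of the solution**: for an H-matrix `A` and any right-hand side `b`,
`|A⁻¹ b| ≤ 𝓜(A)⁻¹ |b|` componentwise. [cite: Axelsson1994, Lemma 8.15] [cite: Ostrowski1937] -/
theorem norm_inv_mulVec_le_comparisonInv_mulVec (hu : ∀ i, 0 < u i)
    (hMu : ∀ i, 0 < (comparisonMatrix A *ᵥ u) i) (b : n → K) (i : n) :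
    ‖(A⁻¹ *ᵥ b) i‖ ≤ ((comparisonMatrix A)⁻¹ *ᵥ fun j => ‖b j‖) i := by
  have h1 := norm_apply_le_comparisonInv_mulVec hu hMu (A⁻¹ *ᵥ b) i
  rwa [mulVec_mulVec, mul_nonsing_inv A (isUnit_det_of_comparison_semipositive hu hMu),
    one_mulVec] at h1

/-- **Ostrowski's theorem (1937)**: for an H-matrix `A` (`u ≫ 0` with `𝓜(A) u ≫ 0`), the inverse
is dominated entrywise by the inverse of the comparison matrix, `‖(A⁻¹)ᵢⱼ‖ ≤ (𝓜(A)⁻¹)ᵢⱼ`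
(the majorisation applied to the `j`-th unit vector).
[cite: Axelsson1994, Lemma 8.15] [cite: Ostrowski1937] -/
theorem norm_inv_apply_le_comparisonInv (hu : ∀ i, 0 < u i)
    (hMu : ∀ i, 0 < (comparisonMatrix A *ᵥ u) i) (i j : n) :
    ‖A⁻¹ i j‖ ≤ (comparisonMatrix A)⁻¹ i j := by
  have h1 := norm_inv_mulVec_le_comparisonInv_mulVec hu hMu (Pi.single j 1) i
  have hb : (fun k => ‖(Pi.single j (1 : K) : n → K) k‖) = Pi.single j (1 : ℝ) := by
    funext k
    by_cases hk : k = j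
    · rw [hk, Pi.single_eq_same, Pi.single_eq_same, norm_one]
    · rw [Pi.single_eq_of_ne hk, Pi.single_eq_of_ne hk, norm_zero]
  rw [hb] at h1
  simpa [mulVec, dotProduct, Pi.single_apply] using h1

/-- The comparison-matrix inverse of an H-matrix is entrywise nonnegative (it dominates `|A⁻¹|`;
also directly (I₂₇) ⇒ (N₃₈) for the Z-matrix `𝓜(A)`). [cite: Axelsson1994, Lemma 8.15]
[cite: BermanPlemmons1994, Ch. 6, Thm. 2.3 (I₂₇) ⇒ (N₃₈)] -/
theorem comparisonInv_nonneg (hu : ∀ i, 0 < u i)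
    (hMu : ∀ i, 0 < (comparisonMatrix A *ᵥ u) i) (i j : n) :
    0 ≤ (comparisonMatrix A)⁻¹ i j :=
  (isZMatrix_comparisonMatrix A).inv_nonneg_of_semipositive hu hMu i j

/-- **Absolute row sums**: `Σⱼ ‖(A⁻¹)ᵢⱼ‖ ≤ Σⱼ (𝓜(A)⁻¹)ᵢⱼ` for an H-matrix `A`.
[cite: Axelsson1994, Lemma 8.15] [cite: Varga1976MMatrixTheory, §4 Thm 2 (4.7)] -/
theorem sum_norm_inv_row_le_comparisonInv (hu : ∀ i, 0 < u i)
    (hMu : ∀ i, 0 < (comparisonMatrix A *ᵥ u) i) (i : n) :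
    ∑ j, ‖A⁻¹ i j‖ ≤ ∑ j, (comparisonMatrix A)⁻¹ i j :=
  sum_le_sum fun j _ => norm_inv_apply_le_comparisonInv hu hMu i j

end HMatrix

/-! ### The `ℓ∞` operator norm: `‖A⁻¹‖_∞ ≤ ‖𝓜(A)⁻¹‖_∞` -/

section OperatorNorm

open scoped _root_.Matrix.Norms.Operator

/-- A row's absolute sum is at most the `ℓ∞` operator norm (`‖N‖_∞ = maxᵢ Σⱼ ‖nᵢⱼ‖`).
[folklore] -/
private theorem sum_norm_row_le_linfty_opNorm {L : Type*} [NormedField L] (N : Matrix n n L)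
    (i : n) : ∑ j, ‖N i j‖ ≤ ‖N‖ := by
  rw [linfty_opNorm_def]
  have h : (∑ j, ‖N i j‖₊) ≤ Finset.univ.sup fun i => ∑ j, ‖N i j‖₊ :=
    Finset.le_sup (f := fun i => ∑ j, ‖N i j‖₊) (Finset.mem_univ i)
  have h' := NNReal.coe_le_coe.mpr h
  push_cast at h'
  exact h'

/-- **`‖A⁻¹‖_∞ ≤ ‖𝓜(A)⁻¹‖_∞` for an H-matrix `A`** (`ℓ∞` operator norms; the member `B = A` of
the equimodular set `Ω_A` in Varga's Thm 2 (4.7) `sup_{B ∈ Ω_A} ‖B⁻¹‖_∞ = ‖𝓜(A)⁻¹‖_∞`); also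
`A` is invertible. [cite: Varga1976MMatrixTheory, §4 Thm 2 (4.7)] [cite: Axelsson1994, Lemma 8.15]
[cite: Ostrowski1937] -/
theorem linfty_norm_inv_le_comparisonInv {A : Matrix n n K} {u : n → ℝ} (hu : ∀ i, 0 < u i)
    (hMu : ∀ i, 0 < (comparisonMatrix A *ᵥ u) i) :
    IsUnit A.det ∧ ‖A⁻¹‖ ≤ ‖(comparisonMatrix A)⁻¹‖ := by
  refine ⟨isUnit_det_of_comparison_semipositive hu hMu, ?_⟩
  refine BauerFike.linfty_opNorm_le_of_row_sum_le (norm_nonneg _) fun i => ?_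
  refine (sum_norm_inv_row_le_comparisonInv hu hMu i).trans ?_
  have hrow : ∑ j, (comparisonMatrix A)⁻¹ i j = ∑ j, ‖(comparisonMatrix A)⁻¹ i j‖ :=
    sum_congr rfl fun j _ => (Real.norm_of_nonneg (comparisonInv_nonneg hu hMu i j)).symm
  rw [hrow]
  exact sum_norm_row_le_linfty_opNorm _ i

/-- **`‖A⁻¹‖_∞ ≤ ‖u‖_∞ / δ` via Ostrowski** for an H-matrix with a quantitative margin
`𝓜(A) u ≥ δ 𝟙`, `δ > 0`, `u ≫ 0`: chain `‖A⁻¹‖_∞ ≤ ‖𝓜(A)⁻¹‖_∞ ≤ ‖u‖_∞ / δ` (the second step is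
the M-matrix bound of `…Matrix.ZMatrixSemipositive`); this is Varga's (4.7) read as an upper
bound, cf. `…Matrix.Varah.linfty_norm_inv_le_of_scaled_margin` (same bound, direct proof).
[cite: Varga1976MMatrixTheory, §4 Thm 2 (4.7)] [cite: Axelsson1994, Lemma 8.15] -/
theorem linfty_norm_inv_le_of_comparison_margin {A : Matrix n n K} {u : n → ℝ} {δ : ℝ}
    (hu : ∀ i, 0 < u i) (hδ : 0 < δ) (hMu : ∀ i, δ ≤ (comparisonMatrix A *ᵥ u) i) :
    IsUnit A.det ∧ ‖A⁻¹‖ ≤ ‖u‖ * δ⁻¹ := by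
  have hMu' : ∀ i, 0 < (comparisonMatrix A *ᵥ u) i := fun i => hδ.trans_le (hMu i)
  refine ⟨isUnit_det_of_comparison_semipositive hu hMu', ?_⟩
  exact (linfty_norm_inv_le_comparisonInv hu hMu').2.trans
    ((isZMatrix_comparisonMatrix A).linfty_norm_inv_le_of_semipositive hu hδ hMu).2

end OperatorNorm

end Literature.LinearAlgebra.Matrix
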